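import Summits.CriticalPhenomena.PercolationContinuityZ3.Theses.PercShatteringRace
import Summits.CriticalPhenomena.PercolationContinuityZ3.Theorems.PercShatteringRaceNearLinearTwoClusterDecayConsumedBoxLRO
import Literature.Probability.Percolation.CerfUniquenessZoneBound
import Literature.Probability.Percolation.BondTwoArmsAKN
import Literature.Probability.Percolation.FiniteEnergy

/-!
# Sketch (crux-ideate round 2, ideator 5) for stmt-CriticalPhenomena-5785 `NearLinearTwoClusterDecay`

First-lemma signatures of the two round-2 idea cards
`occupation-rate-relay-bootstrap` (§B) and `radial-freshness-sphere-gluing` (§A), typed over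
existing declarations.  Every `def … : Prop` below is a STATEMENT (nothing is proved here except
the bookkeeping `example`s at the end, which show how the pieces reach the consumed form of the
crux and, with the other crux `S`, the sub-problem statement).
-/

noncomputable section

namespace Summit.CriticalPhenomena.PercolationContinuityZ3.Cruxes.NearLinearTwoClusterDecay.SketchR2I5

open MeasureTheory Filter Topology
open Literature.Probability.LatticeModels Literature.Probability.Percolation
open Summit.CriticalPhenomena.PercolationContinuityZ3.Theses

/-- `P_{p_c}` on `ℤ³` (bond). -/
abbrev Pc : Measure (BondConfig (Site 3)) := bondPercolation (zdGraph 3) (criticalProbI 3)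

/-- `θ(p_c)`. -/
abbrev θc : ℝ := theta (zdGraph 3) 0 (criticalProbI 3)

/-! ## Common vocabulary -/

/-- The CONSUMED form of the crux (hypothesis of the landed
`Theorems.NearLinearTwoClusterDecay.Consumed.raceLemma_of_jumpBoxLRO`, p125450): jump-world
in-box long-range order from the centre at aspect `n^{1+b}`. -/
def JumpBoxLRO (b : ℝ) : Prop :=
  0 < θc → ∃ c : ℝ, 0 < c ∧ ∀ᶠ n : ℕ in atTop, ∀ y ∈ box 3 n,
    c ≤ Pc.real (openConnIn (↑(box 3 ⌈(n : ℝ) ^ (1 + b)⌉₊) : Set (Site 3)) 0 y)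

/-- Pair LRO at aspect exponent `x` (all pairs of `Λ_u`, inside `Λ_{⌈u^x⌉}`), jump world. -/
def PairLRO (x : ℝ) : Prop :=
  0 < θc → ∃ δ : ℝ, 0 < δ ∧ ∀ᶠ u : ℕ in atTop, ∀ a ∈ box 3 u, ∀ b ∈ box 3 u,
    δ ≤ Pc.real (openConnIn (↑(box 3 ⌈(u : ℝ) ^ x⌉₊) : Set (Site 3)) a b)

/-! ## §B  `occupation-rate-relay-bootstrap` -/

/-- **OccRate(σ)** (jump world): a box of radius `u` misses the infinite cluster with probability
`≤ C u^{-σ}`. -/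
def OccRate (σ : ℝ) : Prop :=
  0 < θc → ∃ C : ℝ, ∀ u : ℕ, 1 ≤ u →
    Pc.real {ω | ∀ x ∈ box 3 u, ω ∉ percolatesAt x} ≤ C * (u : ℝ) ^ (-σ)

/-- **FinRad(s)** (jump world): the radius of a FINITE cluster has tail `≤ C r^{-s}`. -/
def FinRad (s : ℝ) : Prop :=
  0 < θc → ∃ C : ℝ, ∀ r : ℕ, 1 ≤ r →
    Pc.real (siteToBoundary 3 r ∩ (percolatesAt (0 : Site 3))ᶜ) ≤ C * (r : ℝ) ^ (-s)

/-- **TwoArm(κ)** (UNCONDITIONAL, at `p_c`): Cerf's/AKN's two-arms event of an edge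
(`AKN.edgeTwoArms`, the two endpoints in distinct clusters of `Λ_m` both reaching `∂ⁱⁿΛ_m`) has
probability `≤ C m^{-κ}`.  In tree: `κ = 1/2 − o(1)` (`AKN.exists_real_edgeTwoArms_le`); Cerf 2015
Thm 1.1 (site): every `κ < 12/23`. -/
def TwoArm (κ : ℝ) : Prop :=
  ∃ C : ℝ, ∀ i : Fin 3, ∀ m : ℕ, 1 ≤ m → Pc.real (AKN.edgeTwoArms i m) ≤ C * (m : ℝ) ^ (-κ)

/-- Two-cluster (union-form) decay at aspect exponent `A` with rate `ζ`, via the tree's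
`uniqZone`: `P_{p_c}((uniqZone u ⌈u^A⌉)ᶜ) ≤ C u^{-ζ}` eventually.  In tree, unconditionally:
`AKN.dkt_prop1` gives some `A < ∞`, `ζ > 0` (DKT 2020 Prop 1). -/
def TwoClusterRate (A ζ : ℝ) : Prop :=
  ∃ C : ℝ, ∀ᶠ u : ℕ in atTop, Pc.real (uniqZone (d := 3) u ⌈(u : ℝ) ^ A⌉₊)ᶜ ≤ C * (u : ℝ) ^ (-ζ)

/-- **B1 (relay chain; provable now).** Harris–FKG (`θ²` for the two endpoints), a straight chain
of `⌈3n/u⌉` relay boxes of radius `u = n^γ` each meeting `C_∞` (union bound paid with `OccRate`),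
and the two-cluster bound for consecutive relays (union bound paid with the rate `ζ`):
`P(0 ↔ y in Λ_{n + 2⌈(3u)^A⌉}) ≥ θ² − (3n/u)(C u^{-σ} + C' u^{-ζ})`.  Exponent bookkeeping only:
`γσ > 1 − γ`, `γζ > 1 − γ`, new aspect `max 1 (γA)`. -/
def RelayChain : Prop :=
  ∀ σ A ζ γ : ℝ, 0 < σ → 1 ≤ A → 0 < ζ → 1 / (1 + σ) < γ → 1 / (1 + ζ) < γ → γ ≤ 1 →
    OccRate σ → TwoClusterRate A ζ → ∀ x : ℝ, max 1 (γ * A) < x → PairLRO x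

/-- **B2 (lossy step = Contreras–Martineau–Tassion 2021 Lemma 6.2 / DKT 2020 §7 (39) for bond `ℤ³`;
provable now, shape of the tree's `AKN.real_compl_uniqZone_le`).**
`P((uniqZone u ⌈u^A⌉)ᶜ) ≤ |∂ⁱⁿΛ_u|² |Λ_m| P(two-arms(⌈u^A⌉/2)) / min_{a,b} P(a ↔ b in Λ_m)` with
`m = ⌈u^x⌉`: exponents `4 + 3x − κA`. -/
def LossyStep : Prop :=
  ∀ x κ A : ℝ, 1 ≤ x → 0 < κ → x < A → 4 + 3 * x < κ * A →
    TwoArm κ → PairLRO x → ∀ ζ : ℝ, ζ < κ * A - 4 - 3 * x → TwoClusterRate A ζ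

/-- **B3 (OccRate from FinRad; provable now).** Disjoint-ball independence: for `|x−y| ≥ 3r`,
`P(x, y ∈ C_∞) ≤ P(x ↔ ∂B(x,r))·P(y ↔ ∂B(y,r)) = (θ + g(r))²`, so
`Cov(1_{x∈C_∞}, 1_{y∈C_∞}) ≤ 3 g(⌊|x−y|/3⌋)` with `g = ` the finite-radius tail; Chebyshev on
`#(Λ_u ∩ C_∞)` (mean `θ|Λ_u|`). -/
def OccRateOfFinRad : Prop := ∀ s : ℝ, 3 < s → FinRad s → OccRate 3

/-- **B4 (the bootstrap; provable now from B1, B2 and `AKN.dkt_prop1`).** Iterating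
`x ↦ (σ + 4 + 3x)/(κ(1+σ)) + ε` from the DKT initial aspect converges below any
`1 + b > (σ+4)/(κ(1+σ) − 3)`. -/
def Bootstrap : Prop :=
  ∀ κ σ b : ℝ, 0 < κ → 0 < σ → 0 ≤ b → 3 < κ * (1 + σ) → (σ + 4) / (κ * (1 + σ) - 3) < 1 + b →
    TwoArm κ → OccRate σ → JumpBoxLRO b

/-! ## §A  `radial-freshness-sphere-gluing` -/

/-- The shell `Λ_R ∖ Λ_{s-1}` as a set of sites (traces on `∂ⁱⁿΛ_s` lie in it). -/
def shellSet (s R : ℕ) : Set (Site 3) := (↑(box 3 R) : Set (Site 3)) \ ↑(box 3 (s - 1))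

/-- A finite set of "sphere-adjacent cross pairs" on `∂ⁱⁿΛ_s`: each pair is a pair of lattice
neighbours on a common face (so the outward 3-edge detour exists), and distinct pairs are far
enough apart (sup-distance `≥ 3`) for their detours to be edge-disjoint. -/
def FacePairs (s : ℕ) (P : Finset (Site 3 × Site 3)) : Prop :=
  (∀ ab ∈ P, ab.1 ∈ innerBoundary (zdGraph 3) (box 3 s) ∧ ab.2 ∈ innerBoundary (zdGraph 3) (box 3 s) ∧
      (zdGraph 3).Adj ab.1 ab.2 ∧ ∃ i : Fin 3, (ab.1 i = s ∧ ab.2 i = s) ∨ (ab.1 i = -(s : ℤ) ∧ ab.2 i = -(s : ℤ))) ∧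
  ∀ ab ∈ P, ∀ ab' ∈ P, ab ≠ ab' → ∃ i : Fin 3, 3 ≤ |ab.1 i - ab'.1 i|

/-- **A1 (InterleaveMerge; provable now, elementary).** Fix roots `x, x'`, a radius `s`, a family
`P` of `k` face pairs, and any event `F` determined by the edges inside `Λ_s`.  On
`F ∩ {each a ∈ C_s(x), each b ∈ C_s(x')}` the `k` outward detours are fresh, independent, each
open with probability `p_c³`; if any is open, `x ↔ x'` inside `Λ_{s+1}`.  Hence
`P(F ∩ pairs ∩ {x ↮ x' in Λ_{s+1}}) ≤ (1 − p_c³)^k · P(F ∩ pairs)`. -/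
def InterleaveMerge : Prop :=
  ∀ (s : ℕ) (x x' : Site 3) (P : Finset (Site 3 × Site 3)) (F : Set (BondConfig (Site 3))),
    1 ≤ s → FacePairs s P →
    DeterminedBy F ((fun e : Site 3 × Site 3 => s(e.1, e.2)) '' ((↑(box 3 s) : Set (Site 3)) ×ˢ (↑(box 3 s) : Set (Site 3)))) →
    MeasurableSet F →
    Pc.real (F ∩ {ω | ∀ ab ∈ P, ω ∈ openConnIn (↑(box 3 s) : Set (Site 3)) x ab.1 ∧
                       ω ∈ openConnIn (↑(box 3 s) : Set (Site 3)) x' ab.2} ∩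
             (openConnIn (↑(box 3 (s + 1)) : Set (Site 3)) x x')ᶜ) ≤
      (1 - (criticalProbI 3 : ℝ) ^ 3) ^ P.card *
        Pc.real (F ∩ {ω | ∀ ab ∈ P, ω ∈ openConnIn (↑(box 3 s) : Set (Site 3)) x ab.1 ∧
                            ω ∈ openConnIn (↑(box 3 s) : Set (Site 3)) x' ab.2})

/-- Edges "known" after exploring `Λ_{s-1}`: those touching `Λ_{s-1}`. -/
def knownEdges (s : ℕ) : Set (Sym2 (Site 3)) := {e | ∃ v ∈ e, v ∈ (↑(box 3 (s - 1)) : Set (Site 3))}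

/-- Fresh shell edges: both endpoints in `Λ_{Ms} ∖ Λ_{s-1}`. -/
def shellEdges (s R : ℕ) : Set (Sym2 (Site 3)) := {e | ∀ v ∈ e, v ∈ shellSet s R}

/-- **PairHazard(M)** — the per-shell input of §A in the exact (essinf) form the hazard iteration
consumes: whatever the known configuration `η` (edges touching `Λ_{s-1}`) with `x ↮ y` so far, the
fresh shell keeps both `x` and `y` alive to `∂ⁱⁿΛ_{Ms}` while still separated with probability
`≤ 1 − c`.  The configuration tested is `η ∪ (ω ∩ shellEdges)`. -/
def PairHazard (M : ℕ) : Prop :=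
  ∃ c : ℝ, 0 < c ∧ ∀ᶠ s : ℕ in atTop, ∀ x ∈ box 3 (s - 1), ∀ y ∈ box 3 (s - 1),
    ∀ η : Set (Sym2 (Site 3)), η ⊆ knownEdges s → η ⊆ (zdGraph 3).edgeSet →
    η ∉ openConnIn (↑(box 3 s) : Set (Site 3)) x y →
    Pc.real {ω | (η ∪ (ω ∩ shellEdges s (M * s))) ∈ toBdry (M * s) x ∧
                 (η ∪ (ω ∩ shellEdges s (M * s))) ∈ toBdry (M * s) y ∧
                 (η ∪ (ω ∩ shellEdges s (M * s))) ∉ openConnIn (↑(box 3 (M * s)) : Set (Site 3)) x y}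
      ≤ 1 - c

/-- **FatSeedGluing(M)** — the model case of `PairHazard` (known configuration = two bare seeds),
the residual atom of §A (NP-class but weaker than `NP_M`): two deterministic seed sets on
`∂ⁱⁿΛ_s`, each "fat" (it crosses the shell `(s, Ms)` with probability `≥ 1 − c/4`), are joined
INSIDE the shell with probability `≥ c`.  Directly simulable (plant two seeds). -/
def FatSeedGluing (M : ℕ) : Prop :=
  ∃ c : ℝ, 0 < c ∧ ∀ᶠ s : ℕ in atTop, ∀ VA VB : Finset (Site 3),
    VA ⊆ innerBoundary (zdGraph 3) (box 3 s) → VB ⊆ innerBoundary (zdGraph 3) (box 3 s) →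
    1 - c / 4 ≤ Pc.real {ω | ∃ a ∈ VA, ∃ z ∈ innerBoundary (zdGraph 3) (box 3 (M * s)),
                            ω ∈ openConnIn (shellSet s (M * s)) a z} →
    1 - c / 4 ≤ Pc.real {ω | ∃ b ∈ VB, ∃ z ∈ innerBoundary (zdGraph 3) (box 3 (M * s)),
                            ω ∈ openConnIn (shellSet s (M * s)) b z} →
    c ≤ Pc.real {ω | ∃ a ∈ VA, ∃ b ∈ VB, ω ∈ openConnIn (shellSet s (M * s)) a b}

/-- **A2 (pair hazard ⇒ consumed form at LINEAR aspect; provable now, pure bookkeeping).**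
For `0, y ∈ C_∞` (probability `≥ θ²`, Harris–FKG) explore `Λ_{s_k - 1}`, `s_k = M^k n`; the
lineages never die, so at each step the bad event of `PairHazard` must occur; conditional
independence of the fresh shell given the known edges (`bondPercolation_real_inter_memDep_le`
pattern) gives `P(0, y ∈ C_∞, 0 ↮ y in Λ_{M^K n}) ≤ (1 − c)^K`, whence `JumpBoxLRO b` for every
`b > 0` (already `K = K(θ, c)` constant: aspect `M^K`, linear up to a constant factor). -/
def HazardToLRO : Prop := ∀ M : ℕ, 2 ≤ M → PairHazard M → ∀ b : ℝ, 0 < b → JumpBoxLRO b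

/-! ## Bookkeeping checks (proved): how the pieces reach the consumed form and the summit -/

/-- `PairLRO (1+b)` gives the consumed form (take `a = 0`). -/
theorem jumpBoxLRO_of_pairLRO {b : ℝ} (h : PairLRO (1 + b)) : JumpBoxLRO b := by
  intro hθ
  obtain ⟨δ, hδ, hev⟩ := h hθ
  exact ⟨δ, hδ, hev.mono fun u hu y hy => hu 0 (zero_mem_box 3 u) y hy⟩

/-- §B reaches the summit with the filed `S(1/2)` at the instance `κ = 3/2`, `σ = 8`
(`(8+4)/((3/2)·9 − 3) = 8/7 < 7/6`, budget `(7/6)(5/2) < 3`). -/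
example (hB : Bootstrap) (hT : TwoArm (3 / 2)) (hO : OccRate 8)
    (hS : PercShatteringRace.FreeSusceptibilityPowerSaving) : _root_.PercolationContinuityZ3 := by
  have hL : JumpBoxLRO (1 / 6) :=
    hB (3 / 2) 8 (1 / 6) (by norm_num) (by norm_num) (by norm_num) (by norm_num) (by norm_num) hT hO
  have e : (3 : ℝ) - 1 / 2 = 5 / 2 := by norm_num
  refine Theorems.NearLinearTwoClusterDecay.Consumed.raceLemma_of_jumpBoxLRO (1 / 2) (1 / 6)
    (by norm_num) (by norm_num) ?_ hL
  rw [e]; exact hS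

/-- §B at the route's second instance `(a, b) = (9/10, 2/5)` with the (numerically) true two-arm
exponent `κ ≈ 1.8` (measured: kit j020669, κ̂ = 1.79) needs only `σ = 4`: `(4+4)/(1.8·5 − 3) = 4/3 < 7/5`. -/
example (hB : Bootstrap) (hT : TwoArm (9 / 5)) (hO : OccRate 4)
    (hS : ∃ C : ℝ, ∀ R : ℕ, 1 ≤ R → ∑ y ∈ box 3 R,
      Pc.real (openConnIn (↑(box 3 R) : Set (Site 3)) 0 y) ≤ C * (R : ℝ) ^ (3 - (9 : ℝ) / 10)) :
    _root_.PercolationContinuityZ3 := by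
  have hL : JumpBoxLRO (2 / 5) :=
    hB (9 / 5) 4 (2 / 5) (by norm_num) (by norm_num) (by norm_num) (by norm_num) (by norm_num) hT hO
  exact Theorems.NearLinearTwoClusterDecay.Consumed.raceLemma_of_jumpBoxLRO (9 / 10) (2 / 5)
    (by norm_num) (by norm_num) hS hL

/-- §A reaches the summit with ANY power saving `a > 0` (LRO at aspect `M^K`, i.e. every `b > 0`;
take `b = a/6`: `(1 + a/6)(3 − a) = 3 − a/2 − a²/6 < 3`). -/
example (hH : HazardToLRO) {M : ℕ} (hM : 2 ≤ M) (hF : PairHazard M) {a : ℝ} (ha : 0 < a)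
    (hS : ∃ C : ℝ, ∀ R : ℕ, 1 ≤ R → ∑ y ∈ box 3 R,
      Pc.real (openConnIn (↑(box 3 R) : Set (Site 3)) 0 y) ≤ C * (R : ℝ) ^ (3 - a)) :
    _root_.PercolationContinuityZ3 :=
  Theorems.NearLinearTwoClusterDecay.Consumed.raceLemma_of_jumpBoxLRO a (a / 6) (by positivity)
    (by nlinarith) hS (hH M hM hF (a / 6) (by positivity))

/-- What neither card reaches: the crux AS FILED (union form, both worlds).  Recorded as the
implication that a crux-plan skeleton would still have to stub: the `θ(p_c) = 0` half `U⁰`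
(hyperscaling-lite, never consumed by `closes`) and the union-form upgrade. -/
def FiledGap : Prop :=
  (θc = 0 → PercShatteringRace.NearLinearTwoClusterDecay) ∧
  (0 < θc → (∀ b : ℝ, 0 < b → JumpBoxLRO b) → PercShatteringRace.NearLinearTwoClusterDecay)

example (h : FiledGap) (hH : HazardToLRO) {M : ℕ} (hM : 2 ≤ M) (hF : PairHazard M) :
    PercShatteringRace.NearLinearTwoClusterDecay := by
  rcases eq_or_lt_of_le (measureReal_nonneg : (0 : ℝ) ≤ θc) with h0 | hpos
  · exact h.1 h0.symm
  · exact h.2 hpos (hH M hM hF)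

end Summit.CriticalPhenomena.PercolationContinuityZ3.Cruxes.NearLinearTwoClusterDecay.SketchR2I5
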